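import Summits.AtomisticToContinuum.Crystallization.Theorems.ChessboardParticlePlanesPeriodicWindowsOfGoodWindows
import Summits.AtomisticToContinuum.Crystallization.Theorems.SquareWellLayerCakeStackingFaultSparsityOfLaminarBarlowWindows

/-!
# Qualitative laminar rigidity by compactness, and `LjLaminarity → LaminarSaturation → StackingFaultSparsity`

Crux `StackingFaultSparsity` (stmt-AtomisticToContinuum-14296, routes `SquareWellLayerCake` /
`LaminarSixThreeThree`), line `Sketch`, lead c7 (reshape 10).

Reshapes 1–7 reduced the crux to the X-type input `LaminarBarlowWindows` (item 14292;
`StackingFaultSparsity_of_laminarBarlowWindows'`, p141795).  Inside route `LaminarSixThreeThree` that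
input is fed by `LjLaminarity` (14293), `LaminarSaturation` (14294) and the QUANTITATIVE rigidity
`LaminarRigidity` (14295, `C(R)·ε`-matching, open).  This file removes 14295 from the dependency cone of
14292 and 14296: the glue `laminarToBarlow_proof` only ever needs, for each target `(R, ε)`, SOME scale
`(R', ε')` at which a GOOD window forces an `(R, ε)`-Barlow window, uniformly in the configuration — and
that QUALITATIVE rigidity follows by compactness + contradiction from the landed exact (`ε = 0`) rigidity
of the `PeriodicWindows` line (lead 3240: `stub_goodLimit` E0a, `stub_hexClosure`, `stub_levelLattice`,
`stub_levelRegistry`, `stub_barlowOfLevels` E0b1–3, all in `Theorems/ChessboardParticlePlanesPeriodicWindows*`):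

* `exists_barlowMatched_of_goodWindows` — along ANY sequence of configurations whose `m`-th member has a
  GOOD window at scale `(m + 2, 1/(m + 1))`, some member's window is `(R, ε)`-Barlow-matched (steps 2–3
  of the landed `barlowWindows_of_goodWindows`, run on an arbitrary sequence instead of a ground-state
  sequence: exact layered local limit, identified as a rotated `barlowStacking a h s` through `0`, read
  back on a window at a scale `≥ R`);
* `stub_qualitativeRigidity` — **qualitative laminar rigidity** (the registered geometric stub of the line `Sketch`, reshape 10, by name and signature): for every `R` and `ε > 0`
  there is a scale `k` such that EVERY GOOD `(k + 2, 1/(k + 1))`-window of EVERY finite configuration is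
  `(R, ε)`-Barlow-matched (contradiction + `choose` over the previous lemma; no rate is claimed);
* `laminarBarlowWindows_of_goodWindowsAE` — GOOD windows a.e. (the consequent of `LaminarSaturation`)
  ⇒ `LaminarBarlowWindows` (item 14292), by `Nat.card` comparison at the scale `k(R, ε)`;
* `LaminarBarlowWindows_of_laminarity_saturation : LjLaminarity → LaminarSaturation → LaminarBarlowWindows`
  — item 14292 from items 14293 ∧ 14294 alone (14295 not needed);
* `StackingFaultSparsity_of_laminarity_saturation` / `'` — the crux (both route copies) from
  14293 ∧ 14294 alone, through p141795.

All `[folklore]` bookkeeping over landed theorems; Mathlib + the two imports; no named fact is used.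
-/

noncomputable section

namespace Summit.AtomisticToContinuum.Crystallization.Theorems.SquareWellLayerCake.StackingFaultSparsity.QualitativeRigidity

open Literature.MathematicalPhysics.StatisticalMechanics Filter Metric
open Summit.AtomisticToContinuum.Crystallization.Theorems.PeriodicWindowsSketch
open Summit.AtomisticToContinuum.Crystallization.Theses.LaminarSixThreeThree (LjLaminarity LaminarSaturation
  LaminarBarlowWindows)

/-- **Some GOOD window of the sequence is Barlow-matched.**  If the `m`-th configuration `x m` has a GOOD
window about `x m (ik m)` at scale `(m + 2, 1/(m + 1))` for every `m`, then for every `R` and `ε > 0` some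
member `m` has its `R`-window about `x m (ik m)` two-way `ε`-matched, after a linear isometry, to the
`R`-window of a point of some `barlowStacking a h s` (`a, h ∈ (1/2, 2)`, `s` a Hägg word).  Steps 2–3 of the
landed `barlowWindows_of_goodWindows` on an arbitrary sequence: E0a exact layered limit `X ∋ 0` along `φ`
after a rotation `B`; E0b1–3 identify `X = A '' barlowStacking a h s`, `h = √(b² − a²/3)`; the two-way
matching of the `φ k`-th rotated window with `X` at a scale `k ≥ R` is read back with `B⁻¹ ∘ A`, `z = 0`.
[folklore] -/
theorem exists_barlowMatched_of_goodWindows (R ε : ℝ) (hε : 0 < ε) (Nk : ℕ → ℕ)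
    (x : (m : ℕ) → Fin (Nk m) → EuclideanSpace ℝ (Fin 3)) (ik : (m : ℕ) → Fin (Nk m))
    (hgood : ∀ m : ℕ, (∃ a b : ℝ, 19 / 20 ≤ a ∧ a ≤ 1 ∧ 19 / 20 ≤ b ∧ b ≤ 1 ∧ ∃ n : EuclideanSpace ℝ (Fin 3), ‖n‖ = 1 ∧ ∃ c : ℤ → ℝ, (∀ k : ℤ, c k + 19 / 25 ≤ c (k + 1)) ∧ ∃ l : Fin (Nk m) → ℤ, (∀ j : Fin (Nk m), dist (x m j) (x m (ik m)) ≤ (m : ℝ) + 2 → |inner ℝ (x m j - x m (ik m)) n - c (l j)| ≤ 1 / ((m : ℝ) + 1)) ∧ (∀ j k : Fin (Nk m), dist (x m j) (x m (ik m)) ≤ (m : ℝ) + 2 → dist (x m k) (x m (ik m)) ≤ (m : ℝ) + 2 → j ≠ k → 19 / 20 ≤ dist (x m j) (x m k)) ∧ ∀ j : Fin (Nk m), dist (x m j) (x m (ik m)) ≤ ((m : ℝ) + 2) / 2 → Nat.card {k : Fin (Nk m) // k ≠ j ∧ l k = l j ∧ dist (x m j) (x m k) ≤ 1} = 6 ∧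 Nat.card {k : Fin (Nk m) // l k = l j + 1 ∧ dist (x m j) (x m k) ≤ 1} = 3 ∧ Nat.card {k : Fin (Nk m) // l k = l j - 1 ∧ dist (x m j) (x m k) ≤ 1} = 3 ∧ ∀ k : Fin (Nk m), k ≠ j → dist (x m j) (x m k) ≤ 1 → (l k = l j → |dist (x m j) (x m k) - a| ≤ 1 / ((m : ℝ) + 1)) ∧ (l k ≠ l j → |dist (x m j) (x m k) - b| ≤ 1 / ((m : ℝ) + 1)))) :
    ∃ m : ℕ, ∃ a h : ℝ, 1 / 2 < a ∧ a < 2 ∧ 1 / 2 < h ∧ h < 2 ∧ ∃ s : ℤ → ℤ, Literature.MathematicalPhysics.StatisticalMechanics.IsHaggSeq s ∧ ∃ z ∈ Literature.MathematicalPhysics.StatisticalMechanics.barlowStacking a h s, ∃ A : EuclideanSpace ℝ (Fin 3) →ₗᵢ[ℝ] EuclideanSpace ℝ (Fin 3), (∀ p ∈ Literature.MathematicalPhysics.StatisticalMechanics.barlowStacking a h s, dist p z ≤ R → ∃ j : Fin (Nk m), dist (x m j) (x m (ik m) + A (p - z)) ≤ ε) ∧ (∀ j : Fin (Nk m), dist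 (x m j) (x m (ik m)) ≤ R → ∃ p ∈ Literature.MathematicalPhysics.StatisticalMechanics.barlowStacking a h s, dist (x m j) (x m (ik m) + A (p - z)) ≤ ε) := by
  -- the exact layered limit (E0a) and its rigidity (E0b1–3)
  obtain ⟨φ, B, X, a, b, hφ, hlim, h0, ha1, ha2, hb1, hb2, hsep, hgap, hsharp, hsix, hup, hdn⟩ :=
    stub_goodLimit Nk x ik hgood
  have hlat := stub_levelLattice X a ha1 ha2 hsep hsix (stub_hexClosure X a ha1 ha2 hsharp hsix)
  obtain ⟨u, v, hu2, hv2, hu, hv, huv, hlev0⟩ := hlat 0 h0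
  set h : ℝ := Real.sqrt (b ^ 2 - a ^ 2 / 3) with hh_def
  obtain ⟨hh1, hh2⟩ := sqrt_gap_bounds ha1 ha2 hb1 hb2
  have ha : 0 < a := by linarith
  have hh : 0 < h := by linarith
  have hlev0' : {q ∈ X | q 2 = 0} = {q | ∃ i j : ℤ, q = (i : ℝ) • u + (j : ℝ) • v} := by
    rw [show (0 : ℝ) = (0 : EuclideanSpace ℝ (Fin 3)) 2 from rfl, hlev0]
    ext q
    simp only [Set.mem_setOf_eq, zero_add]
  have hstep : ∀ p ∈ X, {q ∈ X | q 2 = p 2} = {q | ∃ i j : ℤ, q = p + (i : ℝ) • u + (j : ℝ) • v} →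
      ∃ σ τ : ℝ, (σ = 1 ∨ σ = -1) ∧ (τ = 1 ∨ τ = -1) ∧
        {q ∈ X | q 2 = p 2 + h} =
          {q | ∃ i j : ℤ, q = p + h • EuclideanSpace.single (2 : Fin 3) (1 : ℝ) +
            σ • ((1 / 3 : ℝ) • (u + v)) + (i : ℝ) • u + (j : ℝ) • v} ∧
        {q ∈ X | q 2 = p 2 - h} =
          {q | ∃ i j : ℤ, q = p - h • EuclideanSpace.single (2 : Fin 3) (1 : ℝ) +
            τ • ((1 / 3 : ℝ) • (u + v)) + (i : ℝ) • u + (j : ℝ) • v} ∧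
        ∀ q ∈ X, |q 2 - p 2| < h → q 2 = p 2 := fun p hp hlev =>
    stub_levelRegistry X a b ha1 ha2 hb1 hb2 hsep hgap hlat hup hdn p hp u v hu2 hv2 hu hv huv hlev
  obtain ⟨s, A, hs, hXeq⟩ := stub_barlowOfLevels X a h ha hh h0 u v hu2 hv2 hu hv huv hlev0' hstep
  -- read the matching back on a window at a large scale `k ≥ R`
  obtain ⟨k, hk, hkR⟩ := ((hlim R ε hε).and (Filter.eventually_ge_atTop ⌈R⌉₊)).exists
  have hkR' : R ≤ (φ k : ℝ) + 2 := by
    have h1 : R ≤ (⌈R⌉₊ : ℝ) := Nat.le_ceil R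
    have h2 : (⌈R⌉₊ : ℝ) ≤ (k : ℝ) := by exact_mod_cast hkR
    have h3 : (k : ℝ) ≤ (φ k : ℝ) := by exact_mod_cast hφ.id_le k
    linarith
  have hz : (0 : EuclideanSpace ℝ (Fin 3)) ∈ barlowStacking a h s :=
    ⟨0, 0, 0, by simp [barlowPos]⟩
  refine ⟨φ k, a, h, by linarith, by linarith, hh1, hh2, s, hs, 0, hz,
    B.symm.toLinearIsometry.comp A, ?_, ?_⟩
  · intro p hp hpR
    have hApX : A p ∈ X := by rw [hXeq]; exact ⟨p, hp, rfl⟩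
    have hAp0 : dist (A p) 0 ≤ R := by
      rw [dist_zero_right, A.norm_map, ← dist_zero_right]; exact hpR
    obtain ⟨q, ⟨j, hj, rfl⟩, hq⟩ := hk.1 (A p) hApX hAp0
    refine ⟨j, ?_⟩
    have hcomp : (B.symm.toLinearIsometry.comp A) (p - 0) = B.symm (A p) := by
      rw [sub_zero]; rfl
    rw [hcomp]
    calc dist (x (φ k) j) (x (φ k) (ik (φ k)) + B.symm (A p))
        = dist (B (x (φ k) j - x (φ k) (ik (φ k)))) (A p) := by
          rw [← B.dist_map (x (φ k) j) (x (φ k) (ik (φ k)) + B.symm (A p)), map_add,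
            LinearIsometryEquiv.apply_symm_apply, map_sub, dist_eq_norm, dist_eq_norm]
          congr 1; abel
      _ ≤ ε := hq
  · intro j hj
    have hmem : B (x (φ k) j - x (φ k) (ik (φ k))) ∈ {p | ∃ j : Fin (Nk (φ k)),
        dist (x (φ k) j) (x (φ k) (ik (φ k))) ≤ (φ k : ℝ) + 2 ∧ p = B (x (φ k) j - x (φ k) (ik (φ k)))} :=
      ⟨j, hj.trans hkR', rfl⟩
    have hnorm : dist (B (x (φ k) j - x (φ k) (ik (φ k)))) 0 ≤ R := by
      rw [dist_zero_right, B.norm_map, ← dist_eq_norm]; exact hj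
    obtain ⟨q, hqX, hq⟩ := hk.2 _ hmem hnorm
    rw [hXeq] at hqX
    obtain ⟨p, hp, rfl⟩ := hqX
    refine ⟨p, hp, ?_⟩
    have hcomp : (B.symm.toLinearIsometry.comp A) (p - 0) = B.symm (A p) := by
      rw [sub_zero]; rfl
    rw [hcomp]
    calc dist (x (φ k) j) (x (φ k) (ik (φ k)) + B.symm (A p))
        = dist (B (x (φ k) j - x (φ k) (ik (φ k)))) (A p) := by
          rw [← B.dist_map (x (φ k) j) (x (φ k) (ik (φ k)) + B.symm (A p)), map_add,
            LinearIsometryEquiv.apply_symm_apply, map_sub, dist_eq_norm, dist_eq_norm]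
          congr 1; abel
      _ ≤ ε := hq

/-- **Qualitative laminar rigidity (uniform in the configuration).**  For every radius `R` and tolerance
`ε > 0` there is a scale `k` such that, for EVERY finite configuration `x : Fin N → ℝ³` and every site `i`,
a GOOD `(k + 2, 1/(k + 1))`-window about `x i` (unit normal, `1/(k+1)`-flat integer-indexed levels with gaps
`≥ 19/25` on `B(x i, k + 2)`, separation `≥ 19/20` there, exactly `6 + 3 + 3` partners within distance `1`
with `1/(k+1)`-sharp lengths `a, b ∈ [19/20, 1]` at every particle of the half-window) is two-way
`ε`-matched on `B(x i, R)`, after a linear isometry, to a window of some `barlowStacking a h s`,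
`a, h ∈ (1/2, 2)`, `s` a Hägg word.  Proof: otherwise `choose` a bad GOOD window at every scale and
contradict `exists_barlowMatched_of_goodWindows`.  The `ε = 0` case is the exact rigidity E0b1–3 of the
`PeriodicWindows` line; no rate in `ε` is claimed (the quantitative `C(R)·ε` version is item 14295).
[folklore] -/
theorem stub_qualitativeRigidity :
    ∀ R ε : ℝ, 0 < ε → ∃ kk : ℕ, ∀ (N : ℕ) (x : Fin N → EuclideanSpace ℝ (Fin 3)) (i : Fin N), (∃ a b : ℝ, 19 / 20 ≤ a ∧ a ≤ 1 ∧ 19 / 20 ≤ b ∧ b ≤ 1 ∧ ∃ n : EuclideanSpace ℝ (Fin 3), ‖n‖ = 1 ∧ ∃ c : ℤ → ℝ, (∀ k : ℤ, c k + 19 / 25 ≤ c (k + 1)) ∧ ∃ l : Fin N → ℤ, (∀ j : Fin N, dist (x j) (x i) ≤ (kk : ℝ) + 2 → |inner ℝ (x j - x i) n - c (l j)| ≤ 1 / ((kk : ℝ) + 1)) ∧ (∀ j k : Fin N, dist (x j) (x i) ≤ (kk : ℝ) + 2 → dist (x k) (x i) ≤ (kk : ℝ) + 2 → j ≠ k →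 19 / 20 ≤ dist (x j) (x k)) ∧ ∀ j : Fin N, dist (x j) (x i) ≤ ((kk : ℝ) + 2) / 2 → Nat.card {k : Fin N // k ≠ j ∧ l k = l j ∧ dist (x j) (x k) ≤ 1} = 6 ∧ Nat.card {k : Fin N // l k = l j + 1 ∧ dist (x j) (x k) ≤ 1} = 3 ∧ Nat.card {k : Fin N // l k = l j - 1 ∧ dist (x j) (x k) ≤ 1} = 3 ∧ ∀ k : Fin N, k ≠ j → dist (x j) (x k) ≤ 1 → (l k = l j → |dist (x j) (x k) - a| ≤ 1 / ((kk : ℝ) + 1)) ∧ (l k ≠ l j → |dist (x j) (x k) - b| ≤ 1 / ((kk : ℝ) + 1))) → ∃ a h : ℝ, 1 / 2 < a ∧ a < 2 ∧ 1 / 2 < h ∧ h < 2 ∧ ∃ s : ℤ → ℤ, Literature.MathematicalPhysics.StatisticalMechanics.IsHaggSeq s ∧ ∃ z ∈ Literature.MathematicalPhysics.StatisticalMechanics.barlowStacking a h s, ∃ A : EuclideanSpace ℝ (Fin 3) →ₗᵢ[ℝ] EuclideanSpace ℝ (Fin 3), (∀ p ∈ Literature.MathematicalPhysics.StatisticalMechanics.barlowStacking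 a h s, dist p z ≤ R → ∃ j : Fin N, dist (x j) (x i + A (p - z)) ≤ ε) ∧ (∀ j : Fin N, dist (x j) (x i) ≤ R → ∃ p ∈ Literature.MathematicalPhysics.StatisticalMechanics.barlowStacking a h s, dist (x j) (x i + A (p - z)) ≤ ε) := by
  intro R ε hε
  by_contra hcon
  have H : ∀ m : ℕ, ∃ (N : ℕ) (x : Fin N → EuclideanSpace ℝ (Fin 3)) (i : Fin N),
      (∃ a b : ℝ, 19 / 20 ≤ a ∧ a ≤ 1 ∧ 19 / 20 ≤ b ∧ b ≤ 1 ∧ ∃ n : EuclideanSpace ℝ (Fin 3), ‖n‖ = 1 ∧ ∃ c : ℤ → ℝ, (∀ k : ℤ, c k + 19 / 25 ≤ c (k + 1)) ∧ ∃ l : Fin N → ℤ, (∀ j : Fin N, dist (x j) (x i) ≤ (m : ℝ) + 2 → |inner ℝ (x j - x i) n - c (l j)| ≤ 1 / ((m : ℝ) + 1)) ∧ (∀ j k : Fin N, dist (x j) (x i) ≤ (m : ℝ) + 2 → dist (x k) (x i) ≤ (m : ℝ) + 2 → j ≠ k → 19 / 20 ≤ dist (x j) (x k)) ∧ ∀ j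 : Fin N, dist (x j) (x i) ≤ ((m : ℝ) + 2) / 2 → Nat.card {k : Fin N // k ≠ j ∧ l k = l j ∧ dist (x j) (x k) ≤ 1} = 6 ∧ Nat.card {k : Fin N // l k = l j + 1 ∧ dist (x j) (x k) ≤ 1} = 3 ∧ Nat.card {k : Fin N // l k = l j - 1 ∧ dist (x j) (x k) ≤ 1} = 3 ∧ ∀ k : Fin N, k ≠ j → dist (x j) (x k) ≤ 1 → (l k = l j → |dist (x j) (x k) - a| ≤ 1 / ((m : ℝ) + 1)) ∧ (l k ≠ l j → |dist (x j) (x k) - b| ≤ 1 / ((m : ℝ) + 1))) ∧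
      ¬ (∃ a h : ℝ, 1 / 2 < a ∧ a < 2 ∧ 1 / 2 < h ∧ h < 2 ∧ ∃ s : ℤ → ℤ, Literature.MathematicalPhysics.StatisticalMechanics.IsHaggSeq s ∧ ∃ z ∈ Literature.MathematicalPhysics.StatisticalMechanics.barlowStacking a h s, ∃ A : EuclideanSpace ℝ (Fin 3) →ₗᵢ[ℝ] EuclideanSpace ℝ (Fin 3), (∀ p ∈ Literature.MathematicalPhysics.StatisticalMechanics.barlowStacking a h s, dist p z ≤ R → ∃ j : Fin N, dist (x j) (x i + A (p - z)) ≤ ε) ∧ (∀ j : Fin N, dist (x j) (x i) ≤ R → ∃ p ∈ Literature.MathematicalPhysics.StatisticalMechanics.barlowStacking a h s, dist (x j) (x i + A (p - z)) ≤ ε)) := by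
    intro m
    by_contra hm
    exact hcon ⟨m, fun N x i hg => by_contra fun hb => hm ⟨N, x, i, hg, hb⟩⟩
  choose Nk xk ik hgood hbad using H
  obtain ⟨m, hm⟩ := exists_barlowMatched_of_goodWindows R ε hε Nk xk ik hgood
  exact hbad m hm

/-- **GOOD windows a.e. ⇒ Barlow windows a.e.** (item stmt-14292 `LaminarBarlowWindows` from the
consequent of `LaminarSaturation` alone): at the target `(R, ε)` take the scale `k` of
`stub_qualitativeRigidity`; the non-Barlow-matched particles are among the particles without a
GOOD `(k + 2, 1/(k + 1))`-window, whose fraction tends to `0`. [folklore] -/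
theorem laminarBarlowWindows_of_goodWindowsAE
    (hS0 : ∀ R ε : ℝ, 2 ≤ R → 0 < ε → ∀ x : (N : ℕ) → (Fin N → EuclideanSpace ℝ (Fin 3)), (∀ N, Literature.MathematicalPhysics.StatisticalMechanics.IsGroundState Literature.MathematicalPhysics.StatisticalMechanics.lennardJones (x N)) → Filter.Tendsto (fun N : ℕ => (Nat.card {i : Fin N // ¬ (∃ a b : ℝ, 19 / 20 ≤ a ∧ a ≤ 1 ∧ 19 / 20 ≤ b ∧ b ≤ 1 ∧ ∃ n : EuclideanSpace ℝ (Fin 3), ‖n‖ = 1 ∧ ∃ c : ℤ → ℝ, (∀ k : ℤ, c k + 19 / 25 ≤ c (k + 1)) ∧ ∃ l : Fin N → ℤ, (∀ j : Fin N, dist (x N j) (x N i) ≤ R → |inner ℝ (x N j - x N i) n - c (l j)| ≤ ε) ∧ (∀ j k : Fin N, dist (x N j) (x N i) ≤ R → dist (x N k) (x N i) ≤ R → j ≠ k → 19 / 20 ≤ dist (x N j) (x N k)) ∧ ∀ j : Fin N, dist (x N j) (x N i) ≤ R / 2 → Nat.card {k : Fin N // k ≠ j ∧ l k = l j ∧ dist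 (x N j) (x N k) ≤ 1} = 6 ∧ Nat.card {k : Fin N // l k = l j + 1 ∧ dist (x N j) (x N k) ≤ 1} = 3 ∧ Nat.card {k : Fin N // l k = l j - 1 ∧ dist (x N j) (x N k) ≤ 1} = 3 ∧ ∀ k : Fin N, k ≠ j → dist (x N j) (x N k) ≤ 1 → (l k = l j → |dist (x N j) (x N k) - a| ≤ ε) ∧ (l k ≠ l j → |dist (x N j) (x N k) - b| ≤ ε))} : ℝ) / N) Filter.atTop (nhds 0)) :
    LaminarBarlowWindows := by
  intro R ε _hR hε _hε4 x hx
  obtain ⟨kk, hk⟩ := stub_qualitativeRigidity R ε hε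
  have h2 : (2 : ℝ) ≤ (kk : ℝ) + 2 := by linarith [(Nat.cast_nonneg kk : (0 : ℝ) ≤ kk)]
  have hT := hS0 ((kk : ℝ) + 2) (1 / ((kk : ℝ) + 1)) h2 (by positivity) x hx
  refine squeeze_zero (fun N => by positivity) (fun N => ?_) hT
  refine div_le_div_of_nonneg_right (Nat.cast_le.mpr ?_) (Nat.cast_nonneg N)
  refine Nat.card_le_card_of_injective
    (Subtype.map id fun i hi hgood => hi ?_) (Subtype.map_injective _ Function.injective_id)
  exact hk N (x N) i hgood

/-- **Item 14292 from items 14293 ∧ 14294 alone:** `LjLaminarity → LaminarSaturation → LaminarBarlowWindows`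
(the quantitative rigidity `LaminarRigidity`, item 14295, is not needed). [folklore] -/
theorem LaminarBarlowWindows_of_laminarity_saturation (h14293 : LjLaminarity) (h14294 : LaminarSaturation) :
    LaminarBarlowWindows :=
  laminarBarlowWindows_of_goodWindowsAE (h14294 h14293)

/-- **The crux of stmt-14296 (route `LaminarSixThreeThree` copy) from items 14293 ∧ 14294 alone**, through the
landed conditional closure `StackingFaultSparsity_of_laminarBarlowWindows'` (p141795). [folklore] -/
theorem StackingFaultSparsity_of_laminarity_saturation (h14293 : LjLaminarity) (h14294 : LaminarSaturation) :
    Summit.AtomisticToContinuum.Crystallization.Theses.LaminarSixThreeThree.StackingFaultSparsity :=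
  OfLaminarBarlowWindows.StackingFaultSparsity_of_laminarBarlowWindows'
    (LaminarBarlowWindows_of_laminarity_saturation h14293 h14294)

/-- **The crux of stmt-14296 (route `SquareWellLayerCake` copy) from items 14293 ∧ 14294 alone.** [folklore] -/
theorem StackingFaultSparsity_of_laminarity_saturation' (h14293 : LjLaminarity) (h14294 : LaminarSaturation) :
    Summit.AtomisticToContinuum.Crystallization.Theses.SquareWellLayerCake.StackingFaultSparsity :=
  OfLaminarBarlowWindows.StackingFaultSparsity_of_laminarBarlowWindows
    (LaminarBarlowWindows_of_laminarity_saturation h14293 h14294)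

end Summit.AtomisticToContinuum.Crystallization.Theorems.SquareWellLayerCake.StackingFaultSparsity.QualitativeRigidity

end
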